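import Literature.AlgebraicGeometry.Motives.AbelianVarietyConjugateBiprod
import Mathlib.CategoryTheory.Limits.Shapes.Biproducts
import HarnessLib

/-!
# Base change / Galois conjugation of a FINITE biproduct of abelian varieties: `σ(⨁ᵢ Aᵢ) ≅ ⨁ᵢ σAᵢ`

Layer `Literature/AlgebraicGeometry/Motives`, namespace `Literature.AlgebraicGeometry.Motives.AbelianVariety`.
KERNEL ONLY: theorems; no definition, no named fact, no instance, no `sorry`.  Sequel of ★
`AbelianVarietyConjugateBiprod` (the binary case `σ(A ⊞ B) ≅ σA ⊞ σB`, R60-24) for a `Fintype`-indexed family.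

Base change along a field homomorphism `σ : k → L` (`baseChangeAlong σ`; special case: conjugation `A ↦ A^σ` by
`σ ∈ Aut(L)`, `conjugate σ`) is ADDITIVE on homomorphisms (`Hom.baseChangeAlong_add/_zero/_comp/_id`, hence on finite
sums: `Hom.baseChangeAlong_sum`), so it commutes with finite biproducts: there is an isomorphism
`σ(⨁ᵢ Aᵢ) ≅ ⨁ᵢ σAᵢ` intertwining the base changes of the structure maps `πⱼ`, `ιⱼ` with those of `⨁ᵢ σAᵢ`
(`exists_iso_baseChangeAlong_biproduct`, `exists_iso_conjugate_biproduct`).  As in the binary file, the comparison is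
written BY HAND on the category's CHOSEN biproduct — `biproduct.lift (fun j => σ πⱼ)` with inverse
`biproduct.desc (fun j => σ ιⱼ)`, the identities `ιⱼ ≫ πⱼ = 𝟙`, `ιⱼ ≫ πⱼ′ = 0`, `∑ⱼ πⱼ ≫ ιⱼ = 𝟙` (`biproduct.total`) being
transported by the additive `σ` — so that no instance other than the category's own is involved.  The existence of
finite biproducts is taken as an INSTANCE BINDER `[HasFiniteBiproducts (AbelianVariety k)]` (a `Prop`; the tree's
global instance `hasFiniteBiproducts_inst` of `AlgebraicGeometry/ComplexMultiplication/PrincipalModelOfCMOrder`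
discharges it at every consumer — importing that file here would invert the layering).  Transport of `biproduct.lift`,
`biproduct.desc`, `biproduct.map` through the comparison, and the point identities `(πⱼ x)^σ = (σπⱼ)(x^σ)`
(★ `conjPoints_map`).

Use (cell `hodgecm-mathlib`, road #60 `SiegelS1`, leaf R60-24b; A-p05 MUMFORD-LINE-SPEC v2 §7): the CM-ALGEBRA case
`F = ∏ᵢ Kᵢ` of the main theorem of complex multiplication / the reciprocity law (62) at a special pair with `|ι| > 1`
— the moduli variety of `[J, a]` is ONE abelian variety isogenous to `⨁ᵢ Aᵢ` (principal factors), and the conjugate of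
the product must be read factorwise (★ `MainTheoremCMIsogenyForm` R60-28 per factor, R60-37 transport).

## References
* [Milne2005ShimuraVarieties] J. S. Milne, *Introduction to Shimura varieties* (2005), §11 p. 108 («extension of the
  base field», the functor `V ↦ σV`, `α ↦ σα`).
* [MumfordAV1970] D. Mumford, *Abelian Varieties* (1970), §19 (`A₁ × ⋯ × Aₙ`; `Hom(∏ Aᵢ, C) = ⊕ Hom(Aᵢ, C)`).
* [Shimura1998] G. Shimura, *Abelian Varieties with Complex Multiplication and Modular Functions* (1998), §18.7 p. 129
  (structures for a CM algebra `Y = K₁ ⊕ ⋯ ⊕ K_t`, factorwise).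
-/

universe u

open CategoryTheory CategoryTheory.Limits AlgebraicGeometry

noncomputable section

namespace Literature.AlgebraicGeometry.Motives

namespace AbelianVariety

variable {k : Type u} [Field k] {L : Type u} [Field L]

/-! ### §1 `σ` is additive on finite sums -/

section Along

variable (σ : k →+* L) {A B : AbelianVariety k}

/-- `σ(∑ᵢ fᵢ) = ∑ᵢ σfᵢ` over a finite set (additivity of «`α ↦ σα`»). [cite: Milne2005ShimuraVarieties, §11 p. 108] -/
theorem Hom.baseChangeAlong_sum {ι : Type*} (s : Finset ι) (f : ι → (A ⟶ B)) :
    Hom.baseChangeAlong σ (∑ i ∈ s, f i) = ∑ i ∈ s, Hom.baseChangeAlong σ (f i) := by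
  classical
  induction s using Finset.induction_on with
  | empty => simp [Hom.baseChangeAlong_zero]
  | insert a s ha ih => rw [Finset.sum_insert ha, Finset.sum_insert ha, Hom.baseChangeAlong_add, ih]

/-! ### §2 `σ(⨁ᵢ Aᵢ) ≅ ⨁ᵢ σAᵢ` -/

variable [HasFiniteBiproducts (AbelianVariety k)] [HasFiniteBiproducts (AbelianVariety L)]
  {J : Type} [Fintype J]

/-- **Base change commutes with finite biproducts**: an isomorphism `e : σ(⨁ᵢ Aᵢ) ≅ ⨁ᵢ σAᵢ` with
`e.hom ≫ πⱼ = σπⱼ`, `ιⱼ ≫ e.inv = σιⱼ`, `σιⱼ ≫ e.hom = ιⱼ`, `e.inv ≫ σπⱼ = πⱼ` for every `j`.  Construction: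
`e.hom = biproduct.lift (σπⱼ)ⱼ`, `e.inv = biproduct.desc (σιⱼ)ⱼ`; `ιⱼ ≫ πⱼ = 𝟙`, `ιⱼ ≫ πⱼ′ = 0` and `∑ⱼ πⱼ ≫ ιⱼ = 𝟙` are
transported by the additive `σ` (`Hom.baseChangeAlong_comp/_id/_zero/_sum`).
[cite: Milne2005ShimuraVarieties, §11 p. 108] [cite: MumfordAV1970, §19 (Hom(∏ Aᵢ, C))] -/
theorem exists_iso_baseChangeAlong_biproduct (A : J → AbelianVariety k) :
    ∃ e : (⨁ A).baseChangeAlong σ ≅ ⨁ (fun j => (A j).baseChangeAlong σ),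
      (∀ j, e.hom ≫ biproduct.π (fun j => (A j).baseChangeAlong σ) j = Hom.baseChangeAlong σ (biproduct.π A j)) ∧
      (∀ j, biproduct.ι (fun j => (A j).baseChangeAlong σ) j ≫ e.inv = Hom.baseChangeAlong σ (biproduct.ι A j)) ∧
      (∀ j, Hom.baseChangeAlong σ (biproduct.ι A j) ≫ e.hom = biproduct.ι (fun j => (A j).baseChangeAlong σ) j) ∧
      (∀ j, e.inv ≫ Hom.baseChangeAlong σ (biproduct.π A j) = biproduct.π (fun j => (A j).baseChangeAlong σ) j) := by
  classical
  -- the two candidate maps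
  set φ : (⨁ A).baseChangeAlong σ ⟶ ⨁ (fun j => (A j).baseChangeAlong σ) :=
    biproduct.lift (fun j => Hom.baseChangeAlong σ (biproduct.π A j)) with hφ
  set ψ : (⨁ (fun j => (A j).baseChangeAlong σ)) ⟶ (⨁ A).baseChangeAlong σ :=
    biproduct.desc (fun j => Hom.baseChangeAlong σ (biproduct.ι A j)) with hψ
  -- `σ ι_j ≫ φ = ι_j`
  have hι : ∀ j, Hom.baseChangeAlong σ (biproduct.ι A j) ≫ φ =
      biproduct.ι (fun j => (A j).baseChangeAlong σ) j := fun j => by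
    apply biproduct.hom_ext
    intro j'
    rw [Category.assoc, hφ, biproduct.lift_π, ← Hom.baseChangeAlong_comp]
    by_cases h : j = j'
    · subst h
      rw [biproduct.ι_π_self, biproduct.ι_π_self, Hom.baseChangeAlong_id]
    · rw [biproduct.ι_π_ne _ h, biproduct.ι_π_ne _ h, Hom.baseChangeAlong_zero]
  -- `ψ ≫ φ = 𝟙`
  have h1 : ψ ≫ φ = 𝟙 _ := by
    apply biproduct.hom_ext'
    intro j
    rw [hψ, biproduct.ι_desc_assoc, Category.comp_id]
    exact hι j
  -- `φ ≫ ψ = 𝟙`: `σ(∑ π_j ≫ ι_j) = σ 𝟙`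
  have h2 : φ ≫ ψ = 𝟙 _ := by
    rw [hφ, hψ, biproduct.lift_desc]
    simp_rw [← Hom.baseChangeAlong_comp]
    rw [← Hom.baseChangeAlong_sum, biproduct.total, Hom.baseChangeAlong_id]
  refine ⟨⟨φ, ψ, h2, h1⟩, fun j => ?_, fun j => ?_, hι, fun j => ?_⟩
  · exact biproduct.lift_π _ _
  · exact biproduct.ι_desc _ _
  · -- `ψ ≫ σ π_j = π_j`
    change ψ ≫ Hom.baseChangeAlong σ (biproduct.π A j) = biproduct.π (fun j => (A j).baseChangeAlong σ) j
    apply biproduct.hom_ext'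
    intro j'
    rw [hψ, biproduct.ι_desc_assoc, ← Hom.baseChangeAlong_comp]
    by_cases h : j' = j
    · subst h
      rw [biproduct.ι_π_self, biproduct.ι_π_self, Hom.baseChangeAlong_id]
    · rw [biproduct.ι_π_ne _ h, biproduct.ι_π_ne _ h, Hom.baseChangeAlong_zero]

/-- **`σ⟨gⱼ⟩ⱼ = ⟨σgⱼ⟩ⱼ`** through the comparison: `σ(biproduct.lift g) ≫ e.hom = biproduct.lift (σ gⱼ)ⱼ`.
[cite: MumfordAV1970, §19 (Hom(C, ∏ Aᵢ))] [cite: Milne2005ShimuraVarieties, §11 p. 108] -/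
theorem baseChangeAlong_biproduct_lift {A : J → AbelianVariety k} {C : AbelianVariety k} (g : ∀ j, C ⟶ A j)
    (e : (⨁ A).baseChangeAlong σ ≅ ⨁ (fun j => (A j).baseChangeAlong σ))
    (he : ∀ j, e.hom ≫ biproduct.π (fun j => (A j).baseChangeAlong σ) j = Hom.baseChangeAlong σ (biproduct.π A j)) :
    Hom.baseChangeAlong σ (biproduct.lift g) ≫ e.hom =
      biproduct.lift (fun j => Hom.baseChangeAlong σ (g j)) := by
  apply biproduct.hom_ext
  intro j
  rw [Category.assoc, he, biproduct.lift_π, ← Hom.baseChangeAlong_comp, biproduct.lift_π]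

/-- **`σ[gⱼ]ⱼ = [σgⱼ]ⱼ`** through the comparison: `e.inv ≫ σ(biproduct.desc g) = biproduct.desc (σ gⱼ)ⱼ`.
[cite: MumfordAV1970, §19 (Hom(∏ Aᵢ, C))] [cite: Milne2005ShimuraVarieties, §11 p. 108] -/
theorem baseChangeAlong_biproduct_desc {A : J → AbelianVariety k} {C : AbelianVariety k} (g : ∀ j, A j ⟶ C)
    (e : (⨁ A).baseChangeAlong σ ≅ ⨁ (fun j => (A j).baseChangeAlong σ))
    (he : ∀ j, biproduct.ι (fun j => (A j).baseChangeAlong σ) j ≫ e.inv = Hom.baseChangeAlong σ (biproduct.ι A j)) :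
    e.inv ≫ Hom.baseChangeAlong σ (biproduct.desc g) =
      biproduct.desc (fun j => Hom.baseChangeAlong σ (g j)) := by
  apply biproduct.hom_ext'
  intro j
  rw [← Category.assoc, he, biproduct.ι_desc, ← Hom.baseChangeAlong_comp, biproduct.ι_desc]

/-- **`σ(⨁ⱼ gⱼ)` is `⨁ⱼ σgⱼ`** through the comparisons `e` (of `⨁ A`) and `e′` (of `⨁ B`):
`e.hom ≫ biproduct.map (σgⱼ)ⱼ = σ(biproduct.map g) ≫ e′.hom`. [cite: Milne2005ShimuraVarieties, §11 p. 108] -/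
theorem baseChangeAlong_biproduct_map {A B : J → AbelianVariety k} (g : ∀ j, A j ⟶ B j)
    (e : (⨁ A).baseChangeAlong σ ≅ ⨁ (fun j => (A j).baseChangeAlong σ))
    (he : ∀ j, e.hom ≫ biproduct.π (fun j => (A j).baseChangeAlong σ) j = Hom.baseChangeAlong σ (biproduct.π A j))
    (e' : (⨁ B).baseChangeAlong σ ≅ ⨁ (fun j => (B j).baseChangeAlong σ))
    (he' : ∀ j, e'.hom ≫ biproduct.π (fun j => (B j).baseChangeAlong σ) j = Hom.baseChangeAlong σ (biproduct.π B j)) :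
    e.hom ≫ biproduct.map (fun j => Hom.baseChangeAlong σ (g j)) =
      Hom.baseChangeAlong σ (biproduct.map g) ≫ e'.hom := by
  apply biproduct.hom_ext
  intro j
  rw [Category.assoc, biproduct.map_π, ← Category.assoc, he, Category.assoc, he', ← Hom.baseChangeAlong_comp,
    ← Hom.baseChangeAlong_comp, biproduct.map_π]

end Along

/-! ### §3 The conjugate of a finite biproduct, and points -/

section Conjugate

variable (σ : L ≃+* L)

/-- `(∑ᵢ fᵢ)^σ = ∑ᵢ fᵢ^σ` over a finite set. [cite: Milne2005ShimuraVarieties, §11 p. 108] -/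
theorem Hom.conjugate_sum {A B : AbelianVariety L} {ι : Type*} (s : Finset ι) (f : ι → (A ⟶ B)) :
    Hom.conjugate σ (∑ i ∈ s, f i) = ∑ i ∈ s, Hom.conjugate σ (f i) :=
  Hom.baseChangeAlong_sum σ.toRingHom s f

variable [HasFiniteBiproducts (AbelianVariety L)] {J : Type} [Fintype J]

/-- **`(⨁ᵢ Aᵢ)^σ ≅ ⨁ᵢ Aᵢ^σ`** compatibly with the conjugates of the projections and inclusions (the additive functor
`A ↦ A^σ` preserves finite biproducts; factorwise reading of a structure for `Y = K₁ ⊕ ⋯ ⊕ K_t`).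
[cite: Milne2005ShimuraVarieties, §11 p. 108] [cite: Shimura1998, §18.7 p. 129] -/
theorem exists_iso_conjugate_biproduct (A : J → AbelianVariety L) :
    ∃ e : (⨁ A).conjugate σ ≅ ⨁ (fun j => (A j).conjugate σ),
      (∀ j, e.hom ≫ biproduct.π (fun j => (A j).conjugate σ) j = Hom.conjugate σ (biproduct.π A j)) ∧
      (∀ j, biproduct.ι (fun j => (A j).conjugate σ) j ≫ e.inv = Hom.conjugate σ (biproduct.ι A j)) ∧
      (∀ j, Hom.conjugate σ (biproduct.ι A j) ≫ e.hom = biproduct.ι (fun j => (A j).conjugate σ) j) ∧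
      (∀ j, e.inv ≫ Hom.conjugate σ (biproduct.π A j) = biproduct.π (fun j => (A j).conjugate σ) j) :=
  exists_iso_baseChangeAlong_biproduct σ.toRingHom A

/-- **Points: `(πⱼ x)^σ = πⱼ^σ (x^σ)`** for a point `x` of `⨁ᵢ Aᵢ`, with `πⱼ^σ = (πⱼ)^σ` read through any comparison `e` as
`e.hom ≫ πⱼ`. [cite: Shimura1998, §18.6 Thm. 18.6 (2) p. 125; §18.7 p. 129] [cite: Milne2005ShimuraVarieties, §11 p. 108] -/
theorem conjPoints_map_biproduct_π {A : J → AbelianVariety L}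
    (e : (⨁ A).conjugate σ ≅ ⨁ (fun j => (A j).conjugate σ))
    (he : ∀ j, e.hom ≫ biproduct.π (fun j => (A j).conjugate σ) j = Hom.conjugate σ (biproduct.π A j))
    (j : J) (P : (⨁ A).Points L) :
    (A j).conjPoints σ (AlgPoints.map (biproduct.π A j).hom.hom.hom P) =
      AlgPoints.map (e.hom ≫ biproduct.π (fun j => (A j).conjugate σ) j).hom.hom.hom ((⨁ A).conjPoints σ P) := by
  rw [he]
  exact conjPoints_map σ (biproduct.π A j) P

/-- **Points: `(ιⱼ y)^σ`, read in `⨁ᵢ Aᵢ^σ` through `e`, is `ιⱼ (y^σ)`** for a point `y` of `Aⱼ`.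
[cite: Shimura1998, §18.7 p. 129] [cite: Milne2005ShimuraVarieties, §11 p. 108] -/
theorem conjPoints_map_biproduct_ι {A : J → AbelianVariety L}
    (e : (⨁ A).conjugate σ ≅ ⨁ (fun j => (A j).conjugate σ))
    (he : ∀ j, Hom.conjugate σ (biproduct.ι A j) ≫ e.hom = biproduct.ι (fun j => (A j).conjugate σ) j)
    (j : J) (Q : (A j).Points L) :
    AlgPoints.map e.hom.hom.hom.hom ((⨁ A).conjPoints σ (AlgPoints.map (biproduct.ι A j).hom.hom.hom Q)) =
      AlgPoints.map (biproduct.ι (fun j => (A j).conjugate σ) j).hom.hom.hom ((A j).conjPoints σ Q) := by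
  rw [conjPoints_map σ (biproduct.ι A j) Q, ← he j]
  exact Category.assoc _ _ _

/-- `(biproduct.lift g)^σ ≫ e.hom = biproduct.lift (gⱼ^σ)ⱼ`. [cite: MumfordAV1970, §19 (Hom(C, ∏ Aᵢ))] [cite: Milne2005ShimuraVarieties, §11 p. 108] -/
theorem conjugate_biproduct_lift {A : J → AbelianVariety L} {C : AbelianVariety L} (g : ∀ j, C ⟶ A j)
    (e : (⨁ A).conjugate σ ≅ ⨁ (fun j => (A j).conjugate σ))
    (he : ∀ j, e.hom ≫ biproduct.π (fun j => (A j).conjugate σ) j = Hom.conjugate σ (biproduct.π A j)) :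
    Hom.conjugate σ (biproduct.lift g) ≫ e.hom = biproduct.lift (fun j => Hom.conjugate σ (g j)) :=
  baseChangeAlong_biproduct_lift σ.toRingHom g e he

/-- `e.inv ≫ (biproduct.desc g)^σ = biproduct.desc (gⱼ^σ)ⱼ`. [cite: MumfordAV1970, §19 (Hom(∏ Aᵢ, C))] [cite: Milne2005ShimuraVarieties, §11 p. 108] -/
theorem conjugate_biproduct_desc {A : J → AbelianVariety L} {C : AbelianVariety L} (g : ∀ j, A j ⟶ C)
    (e : (⨁ A).conjugate σ ≅ ⨁ (fun j => (A j).conjugate σ))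
    (he : ∀ j, biproduct.ι (fun j => (A j).conjugate σ) j ≫ e.inv = Hom.conjugate σ (biproduct.ι A j)) :
    e.inv ≫ Hom.conjugate σ (biproduct.desc g) = biproduct.desc (fun j => Hom.conjugate σ (g j)) :=
  baseChangeAlong_biproduct_desc σ.toRingHom g e he

/-- `e.hom ≫ biproduct.map (gⱼ^σ)ⱼ = (biproduct.map g)^σ ≫ e′.hom`. [cite: Milne2005ShimuraVarieties, §11 p. 108] -/
theorem conjugate_biproduct_map {A B : J → AbelianVariety L} (g : ∀ j, A j ⟶ B j)
    (e : (⨁ A).conjugate σ ≅ ⨁ (fun j => (A j).conjugate σ))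
    (he : ∀ j, e.hom ≫ biproduct.π (fun j => (A j).conjugate σ) j = Hom.conjugate σ (biproduct.π A j))
    (e' : (⨁ B).conjugate σ ≅ ⨁ (fun j => (B j).conjugate σ))
    (he' : ∀ j, e'.hom ≫ biproduct.π (fun j => (B j).conjugate σ) j = Hom.conjugate σ (biproduct.π B j)) :
    e.hom ≫ biproduct.map (fun j => Hom.conjugate σ (g j)) = Hom.conjugate σ (biproduct.map g) ≫ e'.hom :=
  baseChangeAlong_biproduct_map σ.toRingHom g e he e' he'

end Conjugate

end AbelianVariety

end Literature.AlgebraicGeometry.Motives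

end
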